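import Literature.NumberTheory.LFunctions.SelbergClassLogDerivDifference
import Literature.Analysis.Complex.WeightedArgumentPrinciple
import HarnessLib

/-!
# Strong multiplicity one for the Selberg class: the pair explicit formula on a rectangle

Layer 5 of the formalisation of K. Soundararajan, *Strong multiplicity one for the Selberg class*,
Canad. Math. Bull. 47 (2004) 468–474 = arXiv:math/0210299 (named fact
`Literature.NumberTheory.LFunctions.Soundararajan2004_strongMultiplicityOne_thinSet`). Pure proof
file (theorems only).

The source applies the explicit formula (5)/(7) (Rudnick–Sarnak) to `F` and to `G` separately and
subtracts, obtaining (9a): `Z_F − Z_G = H_F − H_G − D_F + D_G`. Here the subtraction is done at the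
level of contour integrals, which keeps the contour at finite height and at distance `η` from the
critical line (no convergence questions arise):

* `Soundararajan2004.pair_explicit_formula_rect` — for `R = [1/2 − η, 1/2 + η] × [T₁, T₂]`, a weight
  `g` analytic on `R` with `g(1/2 − η + iy) = conj g(1/2 + η + iy)`, and `Φ_F Φ_G ≠ 0` on `∂R`:
  `2πi ∑_{ρ} (m_F − m_G)(ρ) g(ρ) = ∫_bottom (L g) − ∫_top (L g) + 2i Re ∫_{T₁}^{T₂} (L g)(1/2 + η + iy) dy`,
  `L = Φ_F'/Φ_F − Φ_G'/Φ_G` — the weighted argument principle of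
  `Literature/Analysis/Complex/WeightedArgumentPrinciple.lean` for both factors, the left edge being
  folded onto the right one by `Φ'/Φ(s) = −conj Φ'/Φ(1 − s̄)`
  (`SelbergDatum.logDeriv_completed_eq_neg_conj`).
* `Soundararajan2004.sum_order_sub_eq_sum_filter_re_eq_half` — in the setting of the theorem the
  zeros off the line cancel (`meromorphicOrderAt_completed_eq`), leaving `Z_F − Z_G` of (9b).

On the right edge `L = log(Q_F/Q_G) + (gamma terms) − ∑ c(n) log n n^{-s}`
(`Soundararajan2004.logDeriv_completed_sub`, `SelbergClassLogDerivDifference.lean`); the evaluation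
of the three resulting integrals ((8), the `D`-terms) is carried out in later layers.

## References

* K. Soundararajan, *Strong multiplicity one for the Selberg class*, Canad. Math. Bull. 47 (2004)
  468–474; arXiv:math/0210299, displays (5), (7), (9a), (9b). [Soundararajan2002]
* Z. Rudnick, P. Sarnak, *Zeros of principal L-functions and random matrix theory*, Duke Math. J.
  81 (1996), §2 (the explicit formula). [RudnickSarnak1996]
-/

noncomputable section

open Complex Filter Topology Set Asymptotics MeasureTheory intervalIntegral
open scoped ComplexConjugate Interval

namespace Literature.NumberTheory.LFunctions
namespace Soundararajan2004

open Literature.Analysis.Complex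

section Pair

variable {D₁ D₂ : SelbergDatum}

/-- **The pair explicit formula on a rectangle (Soundararajan's (9a) before evaluation).** Let
`R = [1/2 − η, 1/2 + η] × [T₁, T₂]` (`0 < η < 1/2`, `T₁ < T₂`) and let `g` be analytic on `R` with the
reflection symmetry `g(1/2 − η + iy) = conj g(1/2 + η + iy)` on the vertical edges. If `Φ_F Φ_G ≠ 0`
on `∂R` and `S ⊆ R°` is a finite set containing the zeros of `Φ_F Φ_G` in `R`, then, with
`L = Φ_F'/Φ_F − Φ_G'/Φ_G` and `m_F(ρ), m_G(ρ)` the multiplicities,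

  `2πi ∑_{ρ ∈ S} (m_F(ρ) − m_G(ρ)) g(ρ) = ∫_bottom L g − ∫_top L g + 2i · Re ∫_{T₁}^{T₂} (L g)(1/2 + η + iy) dy`:

the weighted argument principle (`Literature.Analysis.Complex.rectBoundaryIntegral_logDeriv_mul_eq_sum`)
for `Φ_F` and for `Φ_G`, subtracted, the two vertical edges being combined by the functional
equation `Φ'/Φ(s) = −conj Φ'/Φ(1 − s̄)` (`SelbergDatum.logDeriv_completed_eq_neg_conj`). In the
source this is the difference of the explicit formulae (7) for `F` and `G`, i.e. (9a); here the
contour is kept at finite height and at distance `η` from the critical line.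
[cite: Soundararajan2002, (7), (9a)] -/
theorem pair_explicit_formula_rect {η T₁ T₂ : ℝ} (hη0 : 0 < η) (hη : η < 1 / 2) (hT : T₁ < T₂)
    {g : ℂ → ℂ} (hg : AnalyticOnNhd ℂ g (Icc (1 / 2 - η) (1 / 2 + η) ×ℂ Icc T₁ T₂))
    (hg_refl : ∀ y ∈ Icc T₁ T₂,
      g (((1 / 2 - η : ℝ) : ℂ) + y * I) = conj (g (((1 / 2 + η : ℝ) : ℂ) + y * I)))
    (h_bot : ∀ x ∈ Icc (1 / 2 - η) (1 / 2 + η), D₁.completed (x + T₁ * I) ≠ 0 ∧ D₂.completed (x + T₁ * I) ≠ 0)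
    (h_top : ∀ x ∈ Icc (1 / 2 - η) (1 / 2 + η), D₁.completed (x + T₂ * I) ≠ 0 ∧ D₂.completed (x + T₂ * I) ≠ 0)
    (h_left : ∀ y ∈ Icc T₁ T₂, D₁.completed (((1 / 2 - η : ℝ) : ℂ) + y * I) ≠ 0 ∧
      D₂.completed (((1 / 2 - η : ℝ) : ℂ) + y * I) ≠ 0)
    (h_right : ∀ y ∈ Icc T₁ T₂, D₁.completed (((1 / 2 + η : ℝ) : ℂ) + y * I) ≠ 0 ∧
      D₂.completed (((1 / 2 + η : ℝ) : ℂ) + y * I) ≠ 0)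
    (S : Finset ℂ)
    (hS : ∀ z ∈ Icc (1 / 2 - η) (1 / 2 + η) ×ℂ Icc T₁ T₂, D₁.completed z = 0 ∨ D₂.completed z = 0 → z ∈ S)
    (hSsub : (S : Set ℂ) ⊆ Ioo (1 / 2 - η) (1 / 2 + η) ×ℂ Ioo T₁ T₂) :
    2 * Real.pi * I * ∑ ρ ∈ S, (((meromorphicOrderAt D₁.completed ρ).untop₀ : ℂ) -
        ((meromorphicOrderAt D₂.completed ρ).untop₀ : ℂ)) * g ρ =
      (∫ x : ℝ in (1 / 2 - η)..(1 / 2 + η),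
          (logDeriv D₁.completed (x + T₁ * I) - logDeriv D₂.completed (x + T₁ * I)) * g (x + T₁ * I)) -
      (∫ x : ℝ in (1 / 2 - η)..(1 / 2 + η),
          (logDeriv D₁.completed (x + T₂ * I) - logDeriv D₂.completed (x + T₂ * I)) * g (x + T₂ * I)) +
      2 * I * ((∫ y : ℝ in T₁..T₂,
          (logDeriv D₁.completed (((1 / 2 + η : ℝ) : ℂ) + y * I) -
            logDeriv D₂.completed (((1 / 2 + η : ℝ) : ℂ) + y * I)) * g (((1 / 2 + η : ℝ) : ℂ) + y * I)).re : ℂ) := by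
  set a : ℝ := 1 / 2 - η with ha
  set b : ℝ := 1 / 2 + η with hb
  have hab : a < b := by rw [ha, hb]; linarith
  -- the rectangle lies in `{0 < re s, s ≠ 1}`
  have hRsub : Icc a b ×ℂ Icc T₁ T₂ ⊆ {s : ℂ | 0 < s.re ∧ s ≠ 1} := by
    intro z hz
    have h1 : a ≤ z.re := hz.1.1
    have h2 : z.re ≤ b := hz.1.2
    refine ⟨by rw [ha] at h1; linarith, fun h ↦ ?_⟩
    rw [h, hb] at h2; simp at h2; linarith
  have hΦ₁ : AnalyticOnNhd ℂ D₁.completed (Icc a b ×ℂ Icc T₁ T₂) :=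
    D₁.analyticOnNhd_completed.mono hRsub
  have hΦ₂ : AnalyticOnNhd ℂ D₂.completed (Icc a b ×ℂ Icc T₁ T₂) :=
    D₂.analyticOnNhd_completed.mono hRsub
  -- the weighted argument principle for each factor
  have W₁ := rectBoundaryIntegral_logDeriv_mul_eq_sum hab hT hg S D₁.completed hΦ₁
    (fun z hz h0 ↦ hS z hz (Or.inl h0)) hSsub
  have W₂ := rectBoundaryIntegral_logDeriv_mul_eq_sum hab hT hg S D₂.completed hΦ₂
    (fun z hz h0 ↦ hS z hz (Or.inr h0)) hSsub
  -- continuity of the integrands on the edges (for splitting the boundary integral)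
  have hcont : ∀ (D : SelbergDatum), ∀ z ∈ Icc a b ×ℂ Icc T₁ T₂, D.completed z ≠ 0 →
      ContinuousAt (fun w ↦ deriv D.completed w / D.completed w * g w) z := by
    intro D z hz hz0
    have han : AnalyticAt ℂ D.completed z := D.analyticOnNhd_completed z (hRsub hz)
    exact ((han.deriv.continuousAt).div han.continuousAt hz0).mul (hg z hz).continuousAt
  -- membership of edge points
  have mem_bot : ∀ x ∈ Icc a b, ((x : ℂ) + T₁ * I) ∈ Icc a b ×ℂ Icc T₁ T₂ := fun x hx ↦
    ⟨by simpa using hx, by simpa using (left_mem_Icc.mpr hT.le)⟩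
  have mem_top : ∀ x ∈ Icc a b, ((x : ℂ) + T₂ * I) ∈ Icc a b ×ℂ Icc T₁ T₂ := fun x hx ↦
    ⟨by simpa using hx, by simpa using (right_mem_Icc.mpr hT.le)⟩
  have mem_left : ∀ y ∈ Icc T₁ T₂, ((a : ℂ) + y * I) ∈ Icc a b ×ℂ Icc T₁ T₂ := fun y hy ↦
    ⟨by simpa using (left_mem_Icc.mpr hab.le), by simpa using hy⟩
  have mem_right : ∀ y ∈ Icc T₁ T₂, ((b : ℂ) + y * I) ∈ Icc a b ×ℂ Icc T₁ T₂ := fun y hy ↦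
    ⟨by simpa using (right_mem_Icc.mpr hab.le), by simpa using hy⟩
  -- subtract the two identities
  have hdiff : rectBoundaryIntegral (fun z ↦ deriv D₁.completed z / D₁.completed z * g z) a b T₁ T₂ -
      rectBoundaryIntegral (fun z ↦ deriv D₂.completed z / D₂.completed z * g z) a b T₁ T₂ =
      rectBoundaryIntegral (fun z ↦ (logDeriv D₁.completed z - logDeriv D₂.completed z) * g z) a b T₁ T₂ := by
    have hneg : rectBoundaryIntegral (fun z ↦ (logDeriv D₁.completed z - logDeriv D₂.completed z) * g z) a b T₁ T₂ =
        rectBoundaryIntegral (fun z ↦ deriv D₁.completed z / D₁.completed z * g z +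
          (-1) * (deriv D₂.completed z / D₂.completed z * g z)) a b T₁ T₂ := by
      congr 1; funext z; simp only [logDeriv_apply]; ring
    rw [hneg, rectBoundaryIntegral_add (F := fun z ↦ deriv D₁.completed z / D₁.completed z * g z)
      (G := fun z ↦ (-1) * (deriv D₂.completed z / D₂.completed z * g z)) hab.le hT.le
      (fun x hx ↦ hcont D₁ _ (mem_bot x hx) (h_bot x hx).1)
      (fun x hx ↦ hcont D₁ _ (mem_top x hx) (h_top x hx).1)
      (fun y hy ↦ hcont D₁ _ (mem_left y hy) (h_left y hy).1)
      (fun y hy ↦ hcont D₁ _ (mem_right y hy) (h_right y hy).1)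
      (fun x hx ↦ by exact continuousAt_const.mul (hcont D₂ _ (mem_bot x hx) (h_bot x hx).2))
      (fun x hx ↦ by exact continuousAt_const.mul (hcont D₂ _ (mem_top x hx) (h_top x hx).2))
      (fun y hy ↦ by exact continuousAt_const.mul (hcont D₂ _ (mem_left y hy) (h_left y hy).2))
      (fun y hy ↦ by exact continuousAt_const.mul (hcont D₂ _ (mem_right y hy) (h_right y hy).2)),
      rectBoundaryIntegral_const_mul]
    ring
  have key : 2 * Real.pi * I * ∑ ρ ∈ S, (((meromorphicOrderAt D₁.completed ρ).untop₀ : ℂ) -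
        ((meromorphicOrderAt D₂.completed ρ).untop₀ : ℂ)) * g ρ =
      rectBoundaryIntegral (fun z ↦ (logDeriv D₁.completed z - logDeriv D₂.completed z) * g z) a b T₁ T₂ := by
    rw [← hdiff, W₁, W₂, ← mul_sub, ← Finset.sum_sub_distrib]
    congr 1
    exact Finset.sum_congr rfl fun ρ _ ↦ by ring
  rw [key, rectBoundaryIntegral]
  -- the vertical edges: reflect the left one
  set Fz : ℂ → ℂ := fun z ↦ (logDeriv D₁.completed z - logDeriv D₂.completed z) * g z with hFz
  have hrefl : ∀ y ∈ Icc T₁ T₂, Fz ((a : ℂ) + y * I) = -conj (Fz ((b : ℂ) + y * I)) := by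
    intro y hy
    have hs₀ : 0 < ((a : ℂ) + y * I).re := by simp [ha]; linarith
    have hs₁ : ((a : ℂ) + y * I).re < 1 := by simp [ha]; linarith
    have hstar : 1 - conj ((a : ℂ) + y * I) = (b : ℂ) + y * I := by
      apply Complex.ext <;> simp [ha, hb]; ring
    simp only [hFz]
    rw [D₁.logDeriv_completed_eq_neg_conj hs₀ hs₁, D₂.logDeriv_completed_eq_neg_conj hs₀ hs₁, hstar,
      hg_refl y hy]
    simp only [map_mul, map_sub]
    ring
  have hleft : ∫ y : ℝ in T₁..T₂, Fz ((a : ℂ) + y * I) = -conj (∫ y : ℝ in T₁..T₂, Fz ((b : ℂ) + y * I)) := by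
    rw [intervalIntegral.integral_congr (g := fun y ↦ -conj (Fz ((b : ℂ) + y * I)))
      (fun y hy ↦ hrefl y (by rwa [uIcc_of_le hT.le] at hy)),
      intervalIntegral.integral_neg, intervalIntegral.integral_of_le hT.le,
      intervalIntegral.integral_of_le hT.le, integral_conj]
  rw [hleft]
  set J := ∫ y : ℝ in T₁..T₂, Fz ((b : ℂ) + y * I) with hJ
  have h2re : J + conj J = 2 * (J.re : ℂ) := by rw [Complex.add_conj]; push_cast; ring
  have : I * J - I * -conj J = 2 * I * (J.re : ℂ) := by
    rw [show I * J - I * -conj J = I * (J + conj J) by ring, h2re]; ring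
  rw [show (∫ x : ℝ in a..b, Fz (x + T₁ * I)) - (∫ x : ℝ in a..b, Fz (x + T₂ * I)) + I * J - I * -conj J =
    (∫ x : ℝ in a..b, Fz (x + T₁ * I)) - (∫ x : ℝ in a..b, Fz (x + T₂ * I)) + (I * J - I * -conj J) by ring,
    this]

variable {b₁ b₂ : ℕ → ℂ} {θ₁ θ₂ : ℝ} {𝓔 : Set ℕ} {δ₀ C : ℝ}

/-- **Only the zeros on the critical line survive.** In the setting of Soundararajan's theorem
(`F, G ∈ 𝒮` with `a_F(p) = a_G(p)` off a thin set), the multiplicities of `Φ_F` and `Φ_G` agree at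
every zero off the critical line (`meromorphicOrderAt_completed_eq`), so the zero side of
`pair_explicit_formula_rect` is a sum over the zeros `ρ = 1/2 + iγ` on the line:
`∑_{ρ ∈ S} (m_F − m_G)(ρ) g(ρ) = ∑_{ρ ∈ S, re ρ = 1/2} (m_F − m_G)(ρ) g(ρ)` — the left side of (9a),
`Z_F(t,L) − Z_G(t,L)` of (9b). [cite: Soundararajan2002, (9a), (9b)] -/
theorem sum_order_sub_eq_sum_filter_re_eq_half
    (hb₁ : ∀ n, ¬ IsPrimePow n → b₁ n = 0) (hO₁ : b₁ =O[atTop] fun n ↦ (n : ℝ) ^ θ₁)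
    (hexp₁ : ∀ s : ℂ, 1 < s.re → cexp (LSeries b₁ s) = D₁.toFun s)
    (hb₂ : ∀ n, ¬ IsPrimePow n → b₂ n = 0) (hO₂ : b₂ =O[atTop] fun n ↦ (n : ℝ) ^ θ₂)
    (hexp₂ : ∀ s : ℂ, 1 < s.re → cexp (LSeries b₂ s) = D₂.toFun s)
    (hθ₁ : θ₁ < 1 / 2) (hθ₂ : θ₂ < 1 / 2) (hδ : 0 < δ₀)
    (hthin : ∀ x : ℝ, 2 ≤ x →
      (Set.ncard {p : ℕ | p ∈ 𝓔 ∧ p.Prime ∧ (p : ℝ) ≤ x} : ℝ) ≤ C * x ^ (1 / 2 - δ₀))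
    (hagree : ∀ p : ℕ, p.Prime → p ∉ 𝓔 → D₁.coeff p = D₂.coeff p)
    {η T₁ T₂ : ℝ} (hη : η < 1 / 2) (g : ℂ → ℂ) (S : Finset ℂ)
    (hSsub : (S : Set ℂ) ⊆ Ioo (1 / 2 - η) (1 / 2 + η) ×ℂ Ioo T₁ T₂) :
    ∑ ρ ∈ S, (((meromorphicOrderAt D₁.completed ρ).untop₀ : ℂ) -
        ((meromorphicOrderAt D₂.completed ρ).untop₀ : ℂ)) * g ρ =
      ∑ ρ ∈ S.filter (fun ρ ↦ ρ.re = 1 / 2), (((meromorphicOrderAt D₁.completed ρ).untop₀ : ℂ) -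
        ((meromorphicOrderAt D₂.completed ρ).untop₀ : ℂ)) * g ρ := by
  classical
  rw [Finset.sum_filter]
  refine Finset.sum_congr rfl fun ρ hρ ↦ ?_
  split_ifs with h
  · rfl
  · have hmem := hSsub (Finset.mem_coe.mpr hρ)
    have h0 : 0 < ρ.re := by have := hmem.1.1; linarith
    have h1 : ρ.re < 1 := by have := hmem.1.2; linarith
    rw [meromorphicOrderAt_completed_eq hb₁ hO₁ hexp₁ hb₂ hO₂ hexp₂ hθ₁ hθ₂ hδ hthin hagree h0 h1 h,
      sub_self, zero_mul]

end Pair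

end Soundararajan2004
end Literature.NumberTheory.LFunctions

end
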